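import Summits.ABC.IUTFork.Joshi.ATS4RamificationTateDivisor
import Literature.IUT.LogVolume.ThetaTowerRamification
import Literature.NumberTheory.NumberFields.RelativeDifferentExponents
import HarnessLib

/-!
# [J-IV] Lemma 4.1.4 (2) — and hence ALL of Lemma 4.1.4 — DISCHARGED on the tree's genuine theta tower
# `F_tpd ⊆ F ⊆ K ⊆ F(E_F[ℓ])` of a `λ`-line point

Record file of the abc-iut cell, branch E «type Joshi's construction, test vs S» (rung LADDER-ABC:A2.E; seat abc-iut-E-t26,
slot T-26 fallback (1) «DERIVABLE rows of a landed Joshi file», node J4:Lem4.1.4; sequel of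
`Joshi/ATS4RamificationLegendre.lean`, which discharges part (1)). TAKES NO SIDE on [IUTchIII] Cor. 3.12, on Joshi's claims, or
on Mochizuki's reports on them; typed ≠ proved ≠ endorsed. Source: K. Joshi, *Construction of Arithmetic Teichmuller Spaces
IV*, arXiv:2403.10430v2 (UNREFEREED, bib `Joshi2024ATS4`), Lemma 4.1.4 (2), p.38 l.36–39 of the cell render
`HOME/lit/renders/Joshi-arxiv-2403.10430/`: «The extension `L′/L` is unramified outside `{v ∈ V_{L_tpd} : v divides 2·ℓ} ∪
Supp(𝔮_{L_tpd})` and `L′/L` is tamely ramified outside `{v ∈ V_{L_tpd} : v divides 2·ℓ}`» (`L′` = the field of the `ℓ`-torsion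
of `C/L`, [J-III] §3.3 (13); typed as the claim-`Prop` `TowerDatum.Lem414_2` of `Joshi/ATS4RamificationTateDivisor.lean`, with
the printed `V_{L_tpd}`-sets read as the places of `L` over them).

## What is proved (PROOF-ONLY; no new definition, no claim asserted)

MODEL (the tree's typing of [IUTchIV] Thm. 1.10's tower, `Literature.IUT.LogVolume.ThetaTowerRamification`): `L_tpd = F_tpd`,
the field of `λ ∈ U_X` (`NFPoint`, `P.InU`); `L = F` = print's `F_tpd(√−1, E_{F_tpd}[3·5])` (`Cor22.IsThetaField P F`); `L′ = K`
any number field Galois over `F` presented inside the `ℓ`-division field of the Legendre curve `E_F` (`ψ : K →ₐ[F] F̄`,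
`ker ρ̄_{E_F,ℓ} ≤ Gal(F̄/ψ(K))` — the field `F(E_F[ℓ])` itself, or anything between).

* `unramifiedOutside_divisionTower` — `K/F` is unramified outside `{w : p_w ∣ ℓ} ∪ {w over a bad place of λ}`: the tree's
  Prop. 1.8 (vii) theorem `Cor22.ramificationIdx_divisionTower_eq_one` (Néron–Ogg–Shafarevich at a good place `w ∤ ℓ`); the
  printed set `{p_w ∣ 2ℓ} ∪ Supp(𝔮_{L_tpd})|_L` contains it (`unramifiedOutside_divisionTower_printed`).
* `tamelyRamifiedOutside_divisionTower` — `K/F` is tamely ramified outside `{w : p_w ∣ ℓ}` (hence outside the printed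
  `{p_w ∣ 2ℓ}`): `e(u|w)` is a power of `ℓ` at `w ∤ ℓ` (tree `Cor22.not_dvd_ramificationIdx_divisionTower`, Tate curve at a
  multiplicative `w`), so `p_u = p_w ≠ ℓ` does not divide it.
* `lem414_2_of_divisionTower` — `TowerDatum.Lem414_2` for every tower datum `𝓣 : TowerDatum F_tpd F K` with `𝓣.ell = ℓ` prime
  and `Supp(𝔮_{L_tpd}) ⊇` bad places of `λ`; `lem414_of_divisionTower` combines it with part (1) (supplied by the prequel's
  `lem414_1_of_isThetaField`, taken here as a hypothesis so that this file does not import the prequel) into `𝓣.Lem414`.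

On this model Lemma 4.1.4 is therefore a THEOREM (both parts, with exceptional sets SMALLER than printed: `ℓ` is not needed in
(1), `2` is not needed in (2)) — which bears on the LOCATION E-t26 posted on J4:Lem4.1.4(2) ↔ J4:Lem6.4.2 («tamely ramified
outside {ℓ}» used in the proof of Lem. 6.4.2 is what holds here). Classical facts about torsion fields of the Legendre curve,
kernel-checked in the tree; the two glue steps (`relRamIdx` = Mathlib's new `Ideal.ramificationIdx`; `n ∈ 𝔭_w ↔ p_w ∣ n`) are
inlined so that the file depends only on `ATS4RamificationTateDivisor` and Literature; no binding of `Cor312*`/`Thm311*` (R14);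
nothing here bears on S.
-/

noncomputable section

open NumberField IsDedekindDomain Finset
open Literature.IUT.LogVolume Literature.IUT.LogVolume.Cor22
open Literature.NumberTheory.DiophantineGeometry.GenEll

namespace Summit.ABC.IUTFork.Joshi.ATS4

section Glue

variable {A B : Type*} [Field A] [Field B] [Algebra A B]

/-- `p_w ∣ n ⟺ n ∈ 𝔭_w` (tree `natCast_mem_iff_absNorm_under_dvd`; `p_w` = tree `residueChar`). [folklore] -/
private theorem residueChar_dvd_iff [NumberField B] (w : HeightOneSpectrum (𝓞 B)) (n : ℕ) :
    residueChar B w ∣ n ↔ ((n : ℕ) : 𝓞 B) ∈ w.asIdeal :=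
  (Literature.NumberTheory.NumberFields.natCast_mem_iff_absNorm_under_dvd B w.asIdeal n).symm

/-- `e_{w|v}` of [J-IV] §4.2 (`relRamIdx`, Mathlib `Ideal.ramificationIdx'`) as Mathlib's new `Ideal.ramificationIdx`. [folklore] -/
private theorem relRamIdx_eq [NumberField B] (u : HeightOneSpectrum (𝓞 B)) :
    relRamIdx A B u = u.asIdeal.ramificationIdx (𝓞 A) := by
  haveI : u.asIdeal.IsPrime := u.isPrime
  rw [relRamIdx, Ideal.ramificationIdx'_eq_ramificationIdx (p := (finBelow A B u).asIdeal) (q := u.asIdeal)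
    (finBelow A B u).ne_bot]

/-- `p_u = p_w` for `u` over `w = u|_A`. [folklore] -/
private theorem residueChar_eq_below [NumberField A] [NumberField B] (u : HeightOneSpectrum (𝓞 B)) :
    residueChar B u = residueChar A (finBelow A B u) := by
  have hw : ((residueChar A (finBelow A B u) : ℕ) : 𝓞 A) ∈ (finBelow A B u).asIdeal :=
    (residueChar_dvd_iff _ _).mp dvd_rfl
  have hu : ((residueChar A (finBelow A B u) : ℕ) : 𝓞 B) ∈ u.asIdeal := by
    have h := Ideal.mem_comap.mp (show _ ∈ Ideal.comap (algebraMap (𝓞 A) (𝓞 B)) u.asIdeal from hw)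
    rwa [map_natCast] at h
  exact (Nat.prime_dvd_prime_iff_eq (residueChar_prime B u) (residueChar_prime A _)).mp
    ((residueChar_dvd_iff u _).mpr hu)

end Glue

section DivisionTower

variable {P : NFPoint} {F : Type} [Field F] [NumberField F] [Algebra P.F F]
variable {K : Type} [Field K] [NumberField K] [Algebra F K] (ψ : K →ₐ[F] AlgebraicClosure F)

/-- **`L′/L` unramified outside `{w : p_w ∣ ℓ} ∪ {w over a bad place of λ}`** on the model (sharper than print's
`{p_w ∣ 2ℓ} ∪ Supp(𝔮)`): tree `Cor22.ramificationIdx_divisionTower_eq_one` ([IUTchIV] Prop. 1.8 (vii)) in the `UnramifiedOutside`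
vocabulary of [J-IV] Lemma 4.1.4. [cite: Mochizuki2012, IUTchIV Prop 1.8 (vii) p.19] -/
theorem unramifiedOutside_divisionTower (hU : P.InU) (hF : IsThetaField P F) [IsGalois F K] {l : ℕ}
    (hK : letI := thetaCurve_isElliptic hU F
      ((thetaCurve P F).galoisRepTorsion (l : ℤ)).ker ≤ ψ.fieldRange.fixingSubgroup) :
    UnramifiedOutside F K {w | residueChar F w ∣ l ∨ finBelow P.F F w ∈ badPlaces P} := by
  intro u hu
  simp only [Set.mem_setOf_eq, not_or] at hu
  rw [relRamIdx_eq]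
  exact ramificationIdx_divisionTower_eq_one ψ hU hF hK u (fun h => hu.1 ((residueChar_dvd_iff _ _).mpr h)) hu.2

/-- **[J-IV] Lemma 4.1.4 (2), unramified half, with the PRINTED exceptional set** `{w : p_w ∣ 2·ℓ} ∪ {w over Supp(𝔮_{L_tpd})}`
for any `Supp(𝔮_{L_tpd}) ⊇` bad places of `λ` (monotonicity). [cite: Mochizuki2012, IUTchIV Prop 1.8 (vii) p.19] -/
theorem unramifiedOutside_divisionTower_printed (hU : P.InU) (hF : IsThetaField P F) [IsGalois F K] {l : ℕ}
    (hK : letI := thetaCurve_isElliptic hU F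
      ((thetaCurve P F).galoisRepTorsion (l : ℤ)).ker ≤ ψ.fieldRange.fixingSubgroup)
    {T : Finset (HeightOneSpectrum (𝓞 P.F))} (hT : badPlaces P ⊆ T) :
    UnramifiedOutside F K {w | residueChar F w ∣ 2 * l ∨ finBelow P.F F w ∈ T} :=
  (unramifiedOutside_divisionTower ψ hU hF hK).mono fun _ hw =>
    hw.elim (fun h => Or.inl (Dvd.dvd.mul_left h 2)) fun h => Or.inr (hT h)

/-- **`L′/L` tamely ramified outside `{w : p_w ∣ ℓ}`** on the model (sharper than print's `{p_w ∣ 2ℓ}`): at `w ∤ ℓ` the index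
`e(u|w)` is a power of `ℓ` (tree `Cor22.not_dvd_ramificationIdx_divisionTower`: good place ⇒ `1`, multiplicative place ⇒ Tate
curve), so the residue characteristic `p_u = p_w ≠ ℓ` does not divide it. [cite: Mochizuki2012, IUTchIV Thm 1.10 proof Step (ii) p.24] -/
theorem tamelyRamifiedOutside_divisionTower (hU : P.InU) (hF : IsThetaField P F) [IsGalois F K] {l : ℕ} (hl : l.Prime)
    (hK : letI := thetaCurve_isElliptic hU F
      ((thetaCurve P F).galoisRepTorsion (l : ℤ)).ker ≤ ψ.fieldRange.fixingSubgroup) :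
    TamelyRamifiedOutside F K {w | residueChar F w ∣ l} := by
  intro u hu
  simp only [Set.mem_setOf_eq] at hu
  rw [relRamIdx_eq, residueChar_eq_below (A := F)]
  have hp : (residueChar F (finBelow F K u)).Prime := residueChar_prime F _
  have hpl : residueChar F (finBelow F K u) ≠ l := fun h => hu (h ▸ dvd_rfl)
  exact not_dvd_ramificationIdx_divisionTower ψ hU hF hl hK u (fun h => hu ((residueChar_dvd_iff _ _).mpr h)) hp hpl

/-- **[J-IV] Lemma 4.1.4 (2), tame half, with the PRINTED exceptional set** `{w : p_w ∣ 2·ℓ}` (monotonicity).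
[cite: Mochizuki2012, IUTchIV Thm 1.10 proof Step (ii) p.24] -/
theorem tamelyRamifiedOutside_divisionTower_printed (hU : P.InU) (hF : IsThetaField P F) [IsGalois F K] {l : ℕ}
    (hl : l.Prime)
    (hK : letI := thetaCurve_isElliptic hU F
      ((thetaCurve P F).galoisRepTorsion (l : ℤ)).ker ≤ ψ.fieldRange.fixingSubgroup) :
    TamelyRamifiedOutside F K {w | residueChar F w ∣ 2 * l} := fun u hu =>
  tamelyRamifiedOutside_divisionTower ψ hU hF hl hK u fun h => hu (Dvd.dvd.mul_left h 2)

/-- **[J-IV] Lemma 4.1.4 (2) HOLDS on the genuine theta tower**: for every tower datum `𝓣 : TowerDatum F_tpd F K` with `𝓣.ell = ℓ`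
prime and `Supp(𝔮_{L_tpd}) ⊇` bad places of `λ`, the claim-`Prop` `TowerDatum.Lem414_2` is a theorem.
[cite: Mochizuki2012, IUTchIV Prop 1.8 (vii) p.19] -/
theorem lem414_2_of_divisionTower (hU : P.InU) (hF : IsThetaField P F) [IsGalois F K]
    (𝓣 : TowerDatum P.F F K) (hl : 𝓣.ell.Prime)
    (hK : letI := thetaCurve_isElliptic hU F
      ((thetaCurve P F).galoisRepTorsion (𝓣.ell : ℤ)).ker ≤ ψ.fieldRange.fixingSubgroup)
    (hsupp : badPlaces P ⊆ 𝓣.suppq) : 𝓣.Lem414_2 :=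
  ⟨unramifiedOutside_divisionTower_printed ψ hU hF hK hsupp, tamelyRamifiedOutside_divisionTower_printed ψ hU hF hl hK⟩

/-- **[J-IV] Lemma 4.1.4 (both parts) on the genuine theta tower** `F_tpd ⊆ F = F_tpd(√−1, E[3·5]) ⊆ K ⊆ F(E_F[ℓ])` of a `λ`-line
point: `TowerDatum.Lem414` for every tower datum with `𝓣.ell = ℓ` prime and `Supp(𝔮_{L_tpd}) ⊇` bad places of `λ`, given part (1)
(a theorem on this model: `lem414_1_of_isThetaField` of `Joshi/ATS4RamificationLegendre.lean`, taken as the hypothesis `h1`).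
[cite: Mochizuki2012, IUTchIV Thm 1.10 proof Step (iii) (D0) p.26] -/
theorem lem414_of_divisionTower (hU : P.InU) (hF : IsThetaField P F) [IsGalois F K]
    (𝓣 : TowerDatum P.F F K) (h1 : 𝓣.Lem414_1) (hl : 𝓣.ell.Prime)
    (hK : letI := thetaCurve_isElliptic hU F
      ((thetaCurve P F).galoisRepTorsion (𝓣.ell : ℤ)).ker ≤ ψ.fieldRange.fixingSubgroup)
    (hsupp : badPlaces P ⊆ 𝓣.suppq) : 𝓣.Lem414 :=
  ⟨h1, lem414_2_of_divisionTower ψ hU hF 𝓣 hl hK hsupp⟩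

end DivisionTower

end Summit.ABC.IUTFork.Joshi.ATS4
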